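import Summits.CriticalPhenomena.PercolationContinuityZ3.Theorems.PercNearOneGluingNoHeavyLowerTailCSHDefs
import Literature.Probability.Percolation.ConditionalPositiveAssociationProofs
import Summits.CriticalPhenomena.PercolationContinuityZ3.Theorems.PercNearOneGluingNearOneGluingAttachSetRescueNegCorr
import HarnessLib

/-!
# The conditioned slack hierarchy with an EVENT-REFINED first observer ("pinned CSH") — DEFINITIONS

Definitions file (`--supports stmt-CriticalPhenomena-4575`), route task `nh-dp-fatminority` (line fat-minority-linear, gen 15).
Memo: `run/shared/lean/prim/prim-nh-dp-fatminority/CSH-PSI-MEMO.md`.  No named facts, no sorries; standard axioms.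

PURPOSE.  The single-star inequalities of the fat-minority line (Kozma–Nitzan's (41) / Question 7 / Conjecture 4 with the
conditioning event `{o ↔ A}` REFINED to `E ∩ {o ↔ A}` for an increasing event `E` of the open cluster of the observer `o`:
UT4 / QUT4 for arbitrary up-sets of the observer's edges, QS / QS⁺, and the general-observer form) reduce
(`RefinedPreFKG.conj4_refined_of_twoObserver`, gen 13) to a two-observer margin in which the first observer `o` of the cell's
conditioned slack hierarchy ([W] = `prim-hp-8/CSH-WRITEUP.md`, tree `CSH.*`) is replaced by the PINNED monotone test
`ψ(C_z) = 1{o ∈ C_z} · 1{C_z ∈ 𝓗}` (`𝓗` an upper family of edge sets; on `{z ↔ o}` the edge clusters of `z` and `o` agree, so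
this is `{z ↔ o} ∩ E` with the FIXED event `E = {C_o ∈ 𝓗}`).  Every quantity of the hierarchy that mentions `o` gets its pinned
analogue, everything else is untouched:
* test `1{o ∈ C_z}`                                   ↦ `pinEv o 𝓗 z = {z ↔ o} ∩ {C_z ∈ 𝓗}`;
* decoy constant `c_j(o) = μ(o ∈ C_{d_j} | d_j ↮ Y_j)` ↦ `μ(pinEv o 𝓗 d_j | d_j ↮ Y_j)`      (`pAvoidConst`, `pDecoyList`);
* observers' constant `p = μ(o ∈ C_v | v ↮ Y_{k+1})` ↦ `μ(pinEv o 𝓗 v | v ↮ Y_{k+1})`        (`pObsConst`);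
* the `o`-entry of `CSH.covD`                          ↦ `pCovD` (test `pinEv o 𝓗 x` instead of `{x ↔ o}`).
The level forms `CSH.slForm` / `CSH.cshMarg` are reused unchanged (the pinned quantity is stored AT the label `o`, as in the
mixed hierarchy `MixCSH.*`).  `PinCSH.Holds w o 𝓗 x Y D v` is the statement PIN-CSH(Y; x; D; ψ, v); with `𝓗 = univ` it is
LITERALLY `CSH.CSHHolds w x Y D o v` (`PinCSH.holds_univ_iff`).  The margin is linear in the test, so `[0,1]`-valued pinned
monotone tests are covered by the indicator case.
[cite: KozmaNitzan2024, Conj. 4 (p. 32), Question 7 (p. 36)] [cite: VandenbergHaggstromKahn2005, Thm. 1.3 (p. 6), §2.1 (pp. 9–13)]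
-/

noncomputable section

namespace Summit.CriticalPhenomena.PercolationContinuityZ3.Theorems

open MeasureTheory Set Literature.Probability.LatticeModels Literature.Probability.Percolation
open scoped Classical

namespace PinCSH

variable {V : Type*}

/-- **The pinned test** `pinEv o 𝓗 z = {z ↔ o} ∩ {C_z ∈ 𝓗}` (`C_z` the open EDGE cluster of `z`): the increasing function
`ψ(C_z) = 1{o ∈ C_z}·1{C_z ∈ 𝓗}` of the cluster of `z`, for an upper family `𝓗` of edge sets.
(transcription of the memo prim-nh-dp-fatminority CSH-PSI-MEMO.md §1) [folklore] -/
def pinEv (o : V) (𝓗 : Set (Set (Sym2 V))) (z : V) : Set (BondConfig V) :=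
  (openConn z o : Set (BondConfig V)) ∩ {ω | openEdgeCluster ω z ∈ 𝓗}

/-- Membership in the pinned test. [folklore] -/
theorem mem_pinEv (o : V) (𝓗 : Set (Set (Sym2 V))) (z : V) (ω : BondConfig V) :
    ω ∈ pinEv o 𝓗 z ↔ (openGraph ω).Reachable z o ∧ openEdgeCluster ω z ∈ 𝓗 :=
  Iff.rfl

/-- With `𝓗 = univ` the pinned test is the vertex test `{z ↔ o}`. [folklore] -/
@[simp] theorem pinEv_univ (o z : V) : pinEv o (univ : Set (Set (Sym2 V))) z = openConn z o := by
  ext ω; simp [pinEv]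

/-- **The pinned decoy constant**: at the label `o` it is `μ(d ↮ A, pinEv o 𝓗 d) / μ(d ↮ A)`, at any other vertex `u` the pure
`CSH.avoidConst w d A u = μ(d ↮ A, d ↔ u)/μ(d ↮ A)`. (transcription of the memo prim-nh-dp-fatminority CSH-PSI-MEMO.md §1) [folklore] -/
def pAvoidConst (w : Sym2 V → unitInterval) (o : V) (𝓗 : Set (Set (Sym2 V))) (d : V) (A : Set V) : V → ℝ := fun u =>
  if u = o then
    (prodBernoulli w).real ({ω : BondConfig V | ∀ a ∈ A, ¬ (openGraph ω).Reachable d a} ∩ pinEv o 𝓗 d) /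
      (prodBernoulli w).real {ω : BondConfig V | ∀ a ∈ A, ¬ (openGraph ω).Reachable d a}
  else CSH.avoidConst w d A u

/-- **The pinned decoy/constant list**: decoys `d_1, …, d_k` in order, the `j`-th constant conditioned on
`d_j ↮ A ∪ {d_1..d_{j-1}}`, pinned entry at the label `o`. (transcription of the memo prim-nh-dp-fatminority CSH-PSI-MEMO.md §1) [folklore] -/
def pDecoyList (w : Sym2 V → unitInterval) (o : V) (𝓗 : Set (Set (Sym2 V))) : Set V → List V → List (V × (V → ℝ))
  | _, [] => []
  | A, d :: ds => (d, pAvoidConst w o 𝓗 d A) :: pDecoyList w o 𝓗 (insert d A) ds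

/-- **The pinned observers' constant** `p_ψ = μ(v ↮ A, pinEv o 𝓗 v) / μ(v ↮ A)`.
(transcription of the memo prim-nh-dp-fatminority CSH-PSI-MEMO.md §1) [folklore] -/
def pObsConst (w : Sym2 V → unitInterval) (o : V) (𝓗 : Set (Set (Sym2 V))) (v : V) (A : Set V) : ℝ :=
  (prodBernoulli w).real ({ω : BondConfig V | ∀ a ∈ A, ¬ (openGraph ω).Reachable v a} ∩ pinEv o 𝓗 v) /
    (prodBernoulli w).real {ω : BondConfig V | ∀ a ∈ A, ¬ (openGraph ω).Reachable v a}

/-- **The pinned conditional covariance row**: at the label `o`,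
`μ(D)·∫_{D ∩ pinEv o 𝓗 x} f(C_x) − (∫_D f(C_x))·μ(D ∩ pinEv o 𝓗 x)`, `D = {x ↮ Y}` (`= μ(D)²·Cov(f(C_x), ψ(C_x) | D)`); at any
other vertex the pure `CSH.covD`. (transcription of the memo prim-nh-dp-fatminority CSH-PSI-MEMO.md §1) [folklore] -/
def pCovD (w : Sym2 V → unitInterval) (o : V) (𝓗 : Set (Set (Sym2 V))) (x : V) (Y : Set V) (f : Set (Sym2 V) → ℝ) :
    V → ℝ := fun u =>
  if u = o then
    (prodBernoulli w).real {ω : BondConfig V | ∀ y ∈ Y, ¬ (openGraph ω).Reachable x y} *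
        (∫ ω in {ω : BondConfig V | ∀ y ∈ Y, ¬ (openGraph ω).Reachable x y} ∩ pinEv o 𝓗 x,
          f (openEdgeCluster ω x) ∂(prodBernoulli w)) -
      (∫ ω in {ω : BondConfig V | ∀ y ∈ Y, ¬ (openGraph ω).Reachable x y}, f (openEdgeCluster ω x) ∂(prodBernoulli w)) *
        (prodBernoulli w).real ({ω : BondConfig V | ∀ y ∈ Y, ¬ (openGraph ω).Reachable x y} ∩ pinEv o 𝓗 x)
  else CSH.covD w x Y f u

/-- **The margin of PIN-CSH(Y; x; D; ψ, v)[f]**: the cell's level-form margin `CSH.cshMarg` of the pinned decoy list and the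
pinned observers' constant, applied to the pinned covariance row. (transcription of the memo prim-nh-dp-fatminority CSH-PSI-MEMO.md §1) [folklore] -/
def pMargin (w : Sym2 V → unitInterval) (o : V) (𝓗 : Set (Set (Sym2 V))) (x : V) (Y : Set V) (D : List V) (v : V)
    (f : Set (Sym2 V) → ℝ) : ℝ :=
  CSH.cshMarg (pDecoyList w o 𝓗 (insert x Y) D) (pObsConst w o 𝓗 v (insert x Y ∪ {d | d ∈ D})) o v (pCovD w o 𝓗 x Y f)

/-- **PIN-CSH(Y; x; D; ψ, v)** — the conditioned slack hierarchy with the first observer replaced by the pinned monotone test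
`ψ = 1{o ∈ ·}·1{· ∈ 𝓗}`: the margin is nonnegative for every monotone functional of the open edge cluster of the owner.
(Memo Theorem 1_ψ asserts it for all data with distinct named vertices at non-degenerate weights; exact enumeration: 0
violations, memo §6.) (transcription of the memo prim-nh-dp-fatminority CSH-PSI-MEMO.md §1) [folklore] -/
def Holds (w : Sym2 V → unitInterval) (o : V) (𝓗 : Set (Set (Sym2 V))) (x : V) (Y : Set V) (D : List V) (v : V) : Prop :=
  ∀ f : Set (Sym2 V) → ℝ, Monotone f → 0 ≤ pMargin w o 𝓗 x Y D v f

/-! ### `𝓗 = univ`: the pinned hierarchy is the cell's hierarchy -/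

/-- `{z ↔ o} = {o ↔ z}` as events. [folklore] -/
theorem openConn_comm (o z : V) : (openConn z o : Set (BondConfig V)) = openConn o z := by
  ext ω
  exact ⟨fun h => SimpleGraph.Reachable.symm h, fun h => SimpleGraph.Reachable.symm h⟩

/-- With `𝓗 = univ` the pinned decoy constant is the pure one. [folklore] -/
@[simp] theorem pAvoidConst_univ (w : Sym2 V → unitInterval) (o d : V) (A : Set V) :
    pAvoidConst w o (univ : Set (Set (Sym2 V))) d A = CSH.avoidConst w d A := by
  funext u
  unfold pAvoidConst
  split_ifs with h
  · subst h; simp only [pinEv_univ, CSH.avoidConst]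
  · rfl

/-- With `𝓗 = univ` the pinned decoy list is the pure one. [folklore] -/
@[simp] theorem pDecoyList_univ (w : Sym2 V → unitInterval) (o : V) :
    ∀ (A : Set V) (D : List V), pDecoyList w o (univ : Set (Set (Sym2 V))) A D = CSH.decoyList w A D
  | _, [] => rfl
  | A, d :: ds => by
    simp only [pDecoyList, CSH.decoyList, pAvoidConst_univ, pDecoyList_univ w o (insert d A) ds]

/-- With `𝓗 = univ` the pinned observers' constant is the pure one. [folklore] -/
@[simp] theorem pObsConst_univ (w : Sym2 V → unitInterval) (o v : V) (A : Set V) :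
    pObsConst w o (univ : Set (Set (Sym2 V))) v A = CSH.obsConst w o v A := by
  simp only [pObsConst, pinEv_univ, CSH.obsConst, openConn_comm o v]

/-- With `𝓗 = univ` the pinned covariance row is the pure one. [folklore] -/
@[simp] theorem pCovD_univ (w : Sym2 V → unitInterval) (o x : V) (Y : Set V) (f : Set (Sym2 V) → ℝ) :
    pCovD w o (univ : Set (Set (Sym2 V))) x Y f = CSH.covD w x Y f := by
  funext u
  unfold pCovD
  split_ifs with h
  · subst h; simp only [pinEv_univ, CSH.covD]
  · rfl

/-- With `𝓗 = univ` the pinned margin is the cell's `CSH.cshMargin`. [folklore] -/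
theorem pMargin_univ (w : Sym2 V → unitInterval) (o x : V) (Y : Set V) (D : List V) (v : V) (f : Set (Sym2 V) → ℝ) :
    pMargin w o (univ : Set (Set (Sym2 V))) x Y D v f = CSH.cshMargin w x Y D o v f := by
  simp only [pMargin, CSH.cshMargin, pDecoyList_univ, pObsConst_univ, pCovD_univ]

/-- **With `𝓗 = univ`, PIN-CSH is the cell's CSH** (so memo Theorem 1_ψ contains `CSH.cshHolds`). [folklore] -/
theorem holds_univ_iff (w : Sym2 V → unitInterval) (o x : V) (Y : Set V) (D : List V) (v : V) :
    Holds w o (univ : Set (Set (Sym2 V))) x Y D v ↔ CSH.CSHHolds w x Y D o v := by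
  simp only [Holds, CSH.CSHHolds, pMargin_univ]

/-! ### Elementary facts about the pinned test -/

/-- **The pinned test reads the FIXED event `E = {C_o ∈ 𝓗}`**: `pinEv o 𝓗 z = {z ↔ o} ∩ {C_o ∈ 𝓗}`. [folklore] -/
theorem pinEv_eq_inter_event (o : V) (𝓗 : Set (Set (Sym2 V))) (z : V) :
    pinEv o 𝓗 z = (openConn z o : Set (BondConfig V)) ∩ {ω | openEdgeCluster ω o ∈ 𝓗} := by
  ext ω
  simp only [pinEv, mem_inter_iff, mem_setOf_eq]
  constructor
  · rintro ⟨h1, h2⟩; exact ⟨h1, attachSet_openEdgeCluster_eq_of_reachable (show (openGraph ω).Reachable z o from h1) ▸ h2⟩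
  · rintro ⟨h1, h2⟩; exact ⟨h1, (attachSet_openEdgeCluster_eq_of_reachable (show (openGraph ω).Reachable z o from h1)).symm ▸ h2⟩

/-- **Exclusivity of the pinned test** (the one property of a vertex observer the hierarchy uses): if the pinned test holds at
two vertices `a`, `b` in the same configuration then `a ↔ b`. [folklore] -/
theorem reachable_of_mem_pinEv {o : V} {𝓗 : Set (Set (Sym2 V))} {a b : V} {ω : BondConfig V}
    (ha : ω ∈ pinEv o 𝓗 a) (hb : ω ∈ pinEv o 𝓗 b) : (openGraph ω).Reachable a b :=
  (show (openGraph ω).Reachable a o from ha.1).trans (show (openGraph ω).Reachable b o from hb.1).symm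

/-- The pinned test is an increasing event. [folklore] -/
theorem pinEv_mono {o : V} {𝓗 : Set (Set (Sym2 V))} (h𝓗 : IsUpperSet 𝓗) (z : V) {ω ω' : BondConfig V} (hle : ω ⊆ ω')
    (hω : ω ∈ pinEv o 𝓗 z) : ω' ∈ pinEv o 𝓗 z :=
  ⟨(show (openGraph ω).Reachable z o from hω.1).mono (BHK2006.openGraph_le hle), h𝓗 (BHK2006.openEdgeCluster_mono hle z) hω.2⟩

end PinCSH

end Summit.CriticalPhenomena.PercolationContinuityZ3.Theorems
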